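import Mathlib
import Summits.ValiantsHypothesis.ValiantsHypothesis.Theorems.FifoMatchingNNLinearDegreeCofactorHardShedWordHeartPrelim
import HarnessLib

/-!
# Crux `NNLinearDegreeCofactorHard` (stmt-ValiantsHypothesis-23918), line `internal_cofactor`, stub S2b (ii):
# μ* = shedWord — the band words are BALANCED (unit U6: the drain hypothesis `htail` from the band and a parameter choice)

`…ShedWordQueue.balanced_shedWord` needs `htail : height(E) + #defects[E,N) ≤ #non-defects[E,N)` (the tail is long enough to
drain the queue).  In the band the height at `E` is at most `(freeCount R 0 H + w) + #R`: the S-content is `< F₀ + w` and the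
alive R-items are at most all the R-items, which number at most `#R` (`card_rItems_le`).  So `htail` — hence balance, hence the
support lemma `fifo_shedWord_mem` and the heart `ShedWord.heart` — holds for EVERY band word as soon as the PARAMETERS satisfy
`#R + F₀ + w + defectCount R E N ≤ freeCount R E N` (a `y`-independent inequality; with the carving's good ends, `N − E ≥
2(#R + F₀ + w)` suffices):

* `height_le_sContent_add` — `height(E) ≤ sContent E + #R`;
* `htail_of_band`, `balanced_of_band` — the drain hypothesis and balance for band words under that parameter inequality.

Nothing here proves S2b, the crux or VP ≠ VNP (not proved). [folklore]
-/

noncomputable section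

-- Sub = Summit single-conjunct layout: the duplicated namespace component is mandated by the tree.
set_option linter.dupNamespace false

namespace Summit.ValiantsHypothesis.ValiantsHypothesis.Theorems.FifoMatching.NNLinearDegreeCofactorHard.ShedWord

open Finset Literature.Computability.AlgebraicComplexity

variable {N : ℕ} (R : Finset (Fin N)) (H E : ℕ) (y : Fin N → Bool)

/-- **The height is the S-content plus the alive R-items, and these are at most `#R`** (`t ≤ N`). [folklore] -/
theorem height_le_sContent_add {t : ℕ} (ht : t ≤ N) :
    height (shedPrefix R H E y t) ≤ sContent R H E y t + R.card := by
  classical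
  have hsplit : (Ico (pops (shedPrefix R H E y t)) (pushes (shedPrefix R H E y t))).card =
      ((Ico (pops (shedPrefix R H E y t)) (pushes (shedPrefix R H E y t))).filter fun k => isRItem R H E y k = false).card +
      ((Ico (pops (shedPrefix R H E y t)) (pushes (shedPrefix R H E y t))).filter fun k => ¬ isRItem R H E y k = false).card :=
    (card_filter_add_card_filter_not _).symm
  have hR : ((Ico (pops (shedPrefix R H E y t)) (pushes (shedPrefix R H E y t))).filter
      fun k => ¬ isRItem R H E y k = false).card ≤ R.card := by
    refine le_trans (card_le_card fun k hk => ?_) (card_rItems_le R H E y)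
    rw [mem_filter, mem_Ico] at hk
    rw [mem_filter, mem_range]
    refine ⟨lt_of_lt_of_le hk.1.2 ?_, by simpa using hk.2⟩
    rw [← pushes_shedPrefix_N]; exact pushes_mono R H E y ht
  unfold height sContent
  rw [← Nat.card_Ico, hsplit]
  omega

/-- **The drain hypothesis from the band**: if `|fairWalk| < w` on `[H, E]` (`w ≤ F₀ := freeCount R 0 H`) and the parameters
satisfy `#R + F₀ + w + defectCount R E N ≤ freeCount R E N`, then `height(E) + defectCount R E N ≤ freeCount R E N`. [folklore] -/
theorem htail_of_band (hHE : H ≤ E) (hEN : E ≤ N) {w : ℕ} (hw : w ≤ freeCount R 0 H)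
    (hband : ∀ s, H ≤ s → s ≤ E → |fairWalk R H E y s| < w)
    (hpar : R.card + freeCount R 0 H + w + defectCount R E N ≤ freeCount R E N) :
    height (shedPrefix R H E y E) + defectCount R E N ≤ freeCount R E N := by
  have h1 := height_le_sContent_add R H E y hEN
  have h2 := (sContent_mem_band R H E y hEN hw hHE le_rfl hband).1.2
  have h3 : sContent R H E y E ≤ freeCount R 0 H + w := by exact_mod_cast h2.le
  omega

/-- **Band words are balanced** (even `N`, good ends on the tail, the band, and the parameter inequality). [folklore] -/
theorem balanced_of_band (hN : Even N) (hHE : H ≤ E) (hEN : E ≤ N)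
    (hgood : ∀ t, E ≤ t → t < N → isDefect R t = false → defectCount R t N < freeCount R t N)
    {w : ℕ} (hw : w ≤ freeCount R 0 H) (hband : ∀ s, H ≤ s → s ≤ E → |fairWalk R H E y s| < w)
    (hpar : R.card + freeCount R 0 H + w + defectCount R E N ≤ freeCount R E N) :
    (closerSet (shedWord R H E y)).card = (openerSet (shedWord R H E y)).card :=
  balanced_shedWord R H E y hN hHE hEN hgood (htail_of_band R H E y hHE hEN hw hband hpar)

end Summit.ValiantsHypothesis.ValiantsHypothesis.Theorems.FifoMatching.NNLinearDegreeCofactorHard.ShedWord
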